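import Summits.QuantumFields.BalabanUV.T4Continuum.Support.ShellMeasureRootCompositionNecessity

/-!
# `T4Continuum.ShellMeasureRootCompositionNecessityLevels` — END-I's ACROSS-LEVEL BINDERS (the level-only majorant
# `D_j ≤ D̄`, the live window (W1)) AND ITS [dict] PUSHES (`piece_le`, `total_ge`, `cover`) ARE EACH LOAD-BEARING
(cell `pub-balaban`, sub-cell `t4`, spine estimate NE7c (node U5b); NE7c ROUND-2 crew `t4-ne7c-formalise-*` under
`t4/T4-NE7c-TRIGGER.json`, row S54 of the claim table `t4/b2b-balaban-t4-ne7c-p1/LEAVES-NE7c-P1.md` (owner booking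
v2.2, journal `CLAIMS.log` l.13499: «census file, NOT of record for the countdown»), seat
`b2b-balaban-t4-ne7c-formalise-leaf-01` (gen 4); file 2∕2 (OFFER l.13325) — the NECESSITY companion of row S10
`ShellMeasureRootCompositionToy`; ADDITIVE — imports
file 1 `ShellMeasureRootCompositionNecessity` ONLY (hence S10, S7a `ShellMeasureRootComposition`, Mathlib's Lebesgue
measure), modifies nothing; 0 `def`, 0 sorry, 0 cite; the model data are literal terms.)

HONEST FRAMING.  Finite four-torus programme, rung (B)+1 only — NOT infinite volume, NOT a mass gap, NOT the Clay
problem, NOT summit progress; (B), `BetaPertHyp`, (B^μ) are not consumed.  NE7c = `T4IndicatorShell.ShellWeightBound`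
is NOT PRINTED in [Balaban 1983–89] and NOT PROVED; END-I is the kernel composition «NE7c ⇐ the named binders»
(trigger c3).  THIS FILE IS A FAMILY OF TOYS about END-I's binder SHAPES: nothing of Bałaban's is instantiated, no
estimate of the cell is touched, no binder of the real problem is discharged; (M1) for Bałaban's inductive measures
stays THE wall (GAPS G-ne7cp1-1), located, NOT PRINTED; spine PROVED 0/9 before and after.  Every declaration is
[folklore] kernel mathematics.  HONEST DEPENDENCY (cell, verbatim): continuum YM on T⁴ ⇐ BetaPertH ∧ nine spine
estimates (0/9 proved); BetaPertH ⇐ (D1) ∧ (D4) ∧ CAP+tail; G-an2-4 gates asym, D1 and NE2/3/4.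

WHAT IS PROVED (file 1 did the rate — sharp as `Summable ρ` — and THE WALL (M1); term data of
`T4ShellMeasureLevels.Toy` throughout: one term `()` of weight `A ≡ 1` per step, tested variable the identity on `ℝ`,
threshold `θ ≡ 1`, run B := run A; «the END fails» = `ShellWeightBound l₀ Toy.T Toy.A Toy.A shA shB Wsh` for NO `Wsh`,
by file 1's `not_shellWeightBound_full`):
* §3 `D_j ≤ D̄` NECESSITY: file 1's Dirac-in-shell model (slot law `dirac (1 − ϑ^K∕2)`, widths `ϑ^j`, `0 < ϑ < 1`)
  with the exploding constants `D_j := (ϑ^j)⁻¹` — (M1) now HOLDS (`dirac_slotAC_invPow`: the atom's full mass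
  `1 = ofReal(ϑ^{−K}·ϑ^K)·1`), every other binder holds, `D` admits NO uniform bound (`not_bounded_invPow`), the END
  fails (`invPow_census`): SM-L10's K-uniform LEVEL-ONLY majorant (WALL §2 (j)) is not decoration.
* §4 (W1) NECESSITY — A LIVE SLOT AT EVERY LEVEL: slots `S K = range (K+1)` at levels `lvl K s = s`, uniform laws,
  pieces `ϑ^s`, widths `ϑ^j`, `D ≡ M ≡ 1`, shell part `= 1` (= the level-`0` piece): (R), both pushes, (M1) at every
  slot, `D̄ = 1`, the geometric rate ALL hold, `¬ LiveWindow S lvl N₁ ν̄` for EVERY `N₁ ν̄`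
  (`allLevels_not_liveWindow`), the END fails (`allLevels_census`); END-I's own weight formula reads
  `Σ_{s ≤ K} ϑ^s ≥ 1` here (`allLevels_endWeight_ge_one`) — the window (WALL §2 (i), W-g) is exactly what converts
  node U1b's per-LEVEL rate into a per-STEP rate.
* §5 [dict] PUSH NECESSITY: (a) without `piece_le` — uniform law, geometric widths, piece = shell part `= 1`
  (`noPieceLe_census`; `piece_le` fails at every step `K ≥ 1`); (b) without `total_ge` — uniform law, the exploding
  [dict] constant `M_K := (ϑ^K)⁻¹` makes `piece_le` hold for the piece `1` while `M·μ(univ) = ϑ^{−K} > 1 = Σ A`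
  (`noTotalGe_census`); (c) without `cover` — NO slots at all, every per-slot binder vacuous, the window trivially
  live (`noCover_census`).  Each time every other binder holds and the END fails for every `Wsh`.

WHAT THIS DOES NOT DO.  It is not evidence for or against (W1) or any binder on Bałaban's measures; it changes
nothing in the countdown; it re-exports no END.
-/

open Finset MeasureTheory Set Filter

namespace Summit.QuantumFields.BalabanUV.T4Continuum.ShellMeasureRootCompositionNecessityLevels

open scoped ENNReal Topology
open Literature.MathematicalPhysics.QuantumFieldTheory.Balaban1983to89
open T4IndicatorShell T4ShellMeasure T4ShellMeasureLevels
open ShellMeasureRootComposition ShellMeasureRootCompositionToy ShellMeasureRootCompositionNecessity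


/-! ## §3 `D_j ≤ D̄` NECESSITY: the Dirac model with the exploding constants `D_j = ϑ^{−j}` -/

section InvPow

variable {ϑ : ℝ} (l₀ : ℝ)

/-- **(M1) HOLDS on the Dirac model once the constant may grow with the level**: with `D_K := (ϑ^K)⁻¹` the shell's
full mass `1` is `≤ ofReal (ϑ^{−K}·ϑ^K)·1 = 1` (`0 < ϑ`). [folklore] -/
theorem dirac_slotAC_invPow (h0 : 0 < ϑ) : ∀ K (t : ℝ), |t| ≤ l₀ → ∀ s ∈ Toy.S K,
    SlotAntiConcentration (Measure.dirac (1 - ϑ ^ K / 2)) (fun y : ℝ => y) 1 (Toy.ρ ϑ (Toy.lvl K s))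
      ((fun j : ℕ => (ϑ ^ j)⁻¹) (Toy.lvl K s)) := by
  intro K t _ s _
  show (Measure.dirac (1 - ϑ ^ K / 2)) {y : ℝ | 1 * (1 - ϑ ^ K) ≤ y ∧ y < 1} ≤
    ENNReal.ofReal ((ϑ ^ K)⁻¹ * ϑ ^ K) * (Measure.dirac (1 - ϑ ^ K / 2)) (univ : Set ℝ)
  rw [inv_mul_cancel₀ (pow_ne_zero K h0.ne'), ENNReal.ofReal_one, measure_univ, mul_one]
  exact prob_le_one

/-- the exploding constants are nonnegative (binder `hD0`). [folklore] -/
theorem invPow_nonneg (h0 : 0 < ϑ) (j : ℕ) : 0 ≤ (fun j : ℕ => (ϑ ^ j)⁻¹) j :=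
  inv_nonneg.2 (pow_nonneg h0.le j)

/-- **THE LEVEL-ONLY MAJORANT FAILS**: for `0 < ϑ < 1` the constants `D_j = ϑ^{−j}` are bounded by NO `D̄`.
[folklore] -/
theorem not_bounded_invPow (h0 : 0 < ϑ) (h1 : ϑ < 1) : ¬ ∃ Dbar : ℝ, ∀ j : ℕ, (fun j : ℕ => (ϑ ^ j)⁻¹) j ≤ Dbar := by
  rintro ⟨Dbar, h⟩
  have ht : Tendsto (fun j : ℕ => (ϑ⁻¹) ^ j) atTop atTop :=
    tendsto_pow_atTop_atTop_of_one_lt ((one_lt_inv₀ h0).2 h1)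
  obtain ⟨j, hj⟩ := (ht.eventually (eventually_gt_atTop Dbar)).exists
  exact absurd (h j) (not_le.2 (by simpa only [inv_pow] using hj))

/-- **`D_j ≤ D̄` NECESSITY CENSUS.**  On the Dirac-in-shell model with constants `D_j := (ϑ^j)⁻¹` (`0 < ϑ < 1`,
`0 ≤ l₀`) EVERY binder of END-I except `hD : D_j ≤ D̄` holds — (R), [dict] `hM`∕`piece_le`∕`total_ge`, `hD0`∕`hρ0`,
THE WALL (M1) (now inhabited: the price of an unbounded constant), the window (`N₁ = 0`, `ν̄ = 1`), the geometric
rate —, `D` admits NO uniform bound, and `ShellWeightBound` FAILS FOR EVERY `Wsh`: SM-L10's K-uniform, level-only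
majorant is load-bearing. [folklore] -/
theorem invPow_census (hl₀ : 0 ≤ l₀) (h0 : 0 < ϑ) (h1 : ϑ < 1) :
    (∀ K (t : ℝ), |t| ≤ l₀ → ∀ τ ∈ Toy.T K, 0 ≤ Toy.A K t τ) ∧
    (∀ K (t : ℝ), |t| ≤ l₀ → ∀ τ ∈ Toy.T K, Toy.A K t τ ≤ Toy.A K t τ) ∧
    (∀ K (t : ℝ), |t| ≤ l₀ → ∀ τ ∈ Toy.T K,
      Toy.A K t τ ≤ ∑ s ∈ Toy.S K, (fun (_ : ℕ) (_ : ℝ) (_ : Unit) (_ : Unit) => (1 : ℝ)) K t s τ) ∧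
    (∀ K (t : ℝ), |t| ≤ l₀ → ∀ s ∈ Toy.S K, (0 : ℝ) ≤ 1) ∧
    (∀ K (t : ℝ), |t| ≤ l₀ → ∀ s ∈ Toy.S K,
      ∑ τ ∈ Toy.T K, (fun (_ : ℕ) (_ : ℝ) (_ : Unit) (_ : Unit) => (1 : ℝ)) K t s τ ≤
        1 * ((Measure.dirac (1 - ϑ ^ K / 2))
          {y : ℝ | 1 * (1 - Toy.ρ ϑ (Toy.lvl K s)) ≤ (fun y : ℝ => y) y ∧ (fun y : ℝ => y) y < 1}).toReal) ∧
    (∀ K (t : ℝ), |t| ≤ l₀ → ∀ s ∈ Toy.S K,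
      1 * ((Measure.dirac (1 - ϑ ^ K / 2)) (univ : Set ℝ)).toReal ≤ ∑ τ ∈ Toy.T K, Toy.A K t τ) ∧
    (∀ j, 0 ≤ (fun j : ℕ => (ϑ ^ j)⁻¹) j) ∧ (∀ j, 0 ≤ Toy.ρ ϑ j) ∧
    (∀ K (t : ℝ), |t| ≤ l₀ → ∀ s ∈ Toy.S K, SlotAntiConcentration (Measure.dirac (1 - ϑ ^ K / 2))
      (fun y : ℝ => y) 1 (Toy.ρ ϑ (Toy.lvl K s)) ((fun j : ℕ => (ϑ ^ j)⁻¹) (Toy.lvl K s))) ∧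
    LiveWindow Toy.S Toy.lvl 0 1 ∧ (∀ j, Toy.ρ ϑ j ≤ 1 * ϑ ^ j) ∧
    (¬ ∃ Dbar : ℝ, ∀ j : ℕ, (fun j : ℕ => (ϑ ^ j)⁻¹) j ≤ Dbar) ∧
    ∀ Wsh : ℕ → ℝ, ¬ ShellWeightBound l₀ Toy.T Toy.A Toy.A Toy.A Toy.A Wsh :=
  ⟨fun _ _ _ _ _ => zero_le_one, fun _ _ _ _ _ => le_rfl, dirac_cover l₀, toy_M_nonneg l₀, dirac_piece_le l₀ h0,
    dirac_total_ge l₀, invPow_nonneg h0, fun j => pow_nonneg h0.le j, dirac_slotAC_invPow l₀ h0, Toy.liveWindow,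
    toy_rate h0.le le_rfl, not_bounded_invPow h0 h1, not_shellWeightBound_full hl₀⟩

end InvPow

/-! ## §4 (W1) NECESSITY: a live slot at EVERY level -/

section AllLevels

variable {ϑ : ℝ} (l₀ : ℝ)

/-- (R) `cover` on the all-levels model: the shell part `1` is at most the sum `Σ_{s ≤ K} ϑ^s` of the pieces (its
level-`0` piece is already `1`; `0 ≤ ϑ`). [folklore] -/
theorem allLevels_cover (h0 : 0 ≤ ϑ) : ∀ K (t : ℝ), |t| ≤ l₀ → ∀ τ ∈ Toy.T K,
    Toy.A K t τ ≤ ∑ s ∈ (fun K => Finset.range (K + 1)) K,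
      (fun (_ : ℕ) (_ : ℝ) (s : ℕ) (_ : Unit) => ϑ ^ s) K t s τ := by
  intro K t _ τ _
  show (1 : ℝ) ≤ ∑ s ∈ Finset.range (K + 1), ϑ ^ s
  have h := Finset.single_le_sum (f := fun s => ϑ ^ s) (fun i _ => pow_nonneg h0 i)
    (Finset.mem_range.2 (Nat.succ_pos K))
  simpa using h

/-- [dict] PUSH `piece_le` on the all-levels model, WITH EQUALITY: the level-`s` piece `ϑ^s` weighs `1 ×` the
uniform mass `ϑ^s` of the level-`s` threshold shell (`0 ≤ ϑ ≤ 1`). [folklore] -/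
theorem allLevels_piece_le (h0 : 0 ≤ ϑ) (h1 : ϑ ≤ 1) :
    ∀ K (t : ℝ), |t| ≤ l₀ → ∀ s ∈ (fun K => Finset.range (K + 1)) K,
      ∑ τ ∈ Toy.T K, (fun (_ : ℕ) (_ : ℝ) (s : ℕ) (_ : Unit) => ϑ ^ s) K t s τ ≤
        1 * ((volume.restrict (Icc (0 : ℝ) 1)) {y : ℝ | 1 * (1 - Toy.ρ ϑ ((fun (_ : ℕ) (s : ℕ) => s) K s)) ≤
          (fun y : ℝ => y) y ∧ (fun y : ℝ => y) y < 1}).toReal := by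
  intro K t _ s _
  show ∑ τ ∈ Toy.T K, ϑ ^ s ≤ 1 * ((volume.restrict (Icc (0 : ℝ) 1)) {y : ℝ | 1 * (1 - ϑ ^ s) ≤ y ∧ y < 1}).toReal
  rw [unif_shell (pow_le_one₀ h0 h1), ENNReal.toReal_ofReal (pow_nonneg h0 s)]
  simp [Toy.T]

/-- [dict] PUSH `total_ge` on the all-levels model (uniform law, `M ≡ 1`, weight `1`). [folklore] -/
theorem allLevels_total_ge : ∀ K (t : ℝ), |t| ≤ l₀ → ∀ s ∈ (fun K => Finset.range (K + 1)) K,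
    1 * ((volume.restrict (Icc (0 : ℝ) 1)) (univ : Set ℝ)).toReal ≤ ∑ τ ∈ Toy.T K, Toy.A K t τ := by
  intro K t _ s _
  rw [unif_univ]
  simp [Toy.T, Toy.A]

/-- THE WALL (M1) on the all-levels model: every slot's uniform law is anti-concentrated at its own level's width
`ϑ^s` with `D = 1` (`0 ≤ ϑ ≤ 1`). [folklore] -/
theorem allLevels_slotAC (h0 : 0 ≤ ϑ) (h1 : ϑ ≤ 1) :
    ∀ K (t : ℝ), |t| ≤ l₀ → ∀ s ∈ (fun K => Finset.range (K + 1)) K,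
      SlotAntiConcentration (volume.restrict (Icc (0 : ℝ) 1)) (fun y : ℝ => y) 1
        (Toy.ρ ϑ ((fun (_ : ℕ) (s : ℕ) => s) K s)) (Toy.D ((fun (_ : ℕ) (s : ℕ) => s) K s)) :=
  fun _ _ _ s _ => slotAC_unif (pow_le_one₀ h0 h1 (n := s))

/-- **THE WINDOW FAILS**: with a live slot at every level `0 … K`, `LiveWindow S lvl N₁ ν̄` holds for NO depth `N₁`
and NO count `ν̄` (the level-`0` slot of step `N₁ + 1` is too old). [folklore] -/
theorem allLevels_not_liveWindow (N₁ : ℕ) (νbar : ℝ) :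
    ¬ LiveWindow (fun K => Finset.range (K + 1)) (fun (_ : ℕ) (s : ℕ) => s) N₁ νbar := by
  intro h
  have h' := h.recent (N₁ + 1) 0 (Finset.mem_range.2 (Nat.succ_pos _))
  omega

/-- END-I's OWN weight formula on the all-levels model, `Wsh K = Σ_{s ≤ K} D_s·ρ_s = Σ_{s ≤ K} ϑ^s`, is `≥ 1` at
every step — not summable: without the window the per-LEVEL rate never becomes a per-STEP rate. [folklore] -/
theorem allLevels_endWeight_ge_one (h0 : 0 ≤ ϑ) (K : ℕ) :
    1 ≤ ∑ s ∈ (fun K => Finset.range (K + 1)) K,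
      Toy.D ((fun (_ : ℕ) (s : ℕ) => s) K s) * Toy.ρ ϑ ((fun (_ : ℕ) (s : ℕ) => s) K s) := by
  show (1 : ℝ) ≤ ∑ s ∈ Finset.range (K + 1), Toy.D s * Toy.ρ ϑ s
  have h := Finset.single_le_sum (f := fun s => Toy.D s * Toy.ρ ϑ s)
    (fun i _ => mul_nonneg zero_le_one (pow_nonneg h0 i)) (Finset.mem_range.2 (Nat.succ_pos K))
  simpa [Toy.D, Toy.ρ] using h

/-- **(W1) NECESSITY CENSUS.**  On the all-levels model (`0 < ϑ < 1`, `0 ≤ l₀`; slots `range (K+1)` at levels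
`lvl K s = s`, uniform laws, pieces `ϑ^s`, shell part `= 1 = A`, `ρ_j = ϑ^j`, `D ≡ M ≡ 1`) EVERY binder of END-I
except the window holds — (R), [dict] `hM`∕`piece_le`∕`total_ge`, `hD0`∕`hρ0`, THE WALL (M1) at every slot,
`D_j ≤ D̄ = 1`, the geometric rate —, `LiveWindow` FAILS for every `N₁ ν̄`, and `ShellWeightBound` FAILS FOR EVERY
`Wsh`. [folklore] -/
theorem allLevels_census (hl₀ : 0 ≤ l₀) (h0 : 0 < ϑ) (h1 : ϑ < 1) :
    (∀ K (t : ℝ), |t| ≤ l₀ → ∀ τ ∈ Toy.T K, 0 ≤ Toy.A K t τ) ∧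
    (∀ K (t : ℝ), |t| ≤ l₀ → ∀ τ ∈ Toy.T K, Toy.A K t τ ≤ Toy.A K t τ) ∧
    (∀ K (t : ℝ), |t| ≤ l₀ → ∀ τ ∈ Toy.T K, Toy.A K t τ ≤ ∑ s ∈ (fun K => Finset.range (K + 1)) K,
      (fun (_ : ℕ) (_ : ℝ) (s : ℕ) (_ : Unit) => ϑ ^ s) K t s τ) ∧
    (∀ K (t : ℝ), |t| ≤ l₀ → ∀ s ∈ (fun K => Finset.range (K + 1)) K, (0 : ℝ) ≤ 1) ∧
    (∀ K (t : ℝ), |t| ≤ l₀ → ∀ s ∈ (fun K => Finset.range (K + 1)) K,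
      ∑ τ ∈ Toy.T K, (fun (_ : ℕ) (_ : ℝ) (s : ℕ) (_ : Unit) => ϑ ^ s) K t s τ ≤
        1 * ((volume.restrict (Icc (0 : ℝ) 1)) {y : ℝ | 1 * (1 - Toy.ρ ϑ ((fun (_ : ℕ) (s : ℕ) => s) K s)) ≤
          (fun y : ℝ => y) y ∧ (fun y : ℝ => y) y < 1}).toReal) ∧
    (∀ K (t : ℝ), |t| ≤ l₀ → ∀ s ∈ (fun K => Finset.range (K + 1)) K,
      1 * ((volume.restrict (Icc (0 : ℝ) 1)) (univ : Set ℝ)).toReal ≤ ∑ τ ∈ Toy.T K, Toy.A K t τ) ∧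
    (∀ j, 0 ≤ Toy.D j) ∧ (∀ j, 0 ≤ Toy.ρ ϑ j) ∧
    (∀ K (t : ℝ), |t| ≤ l₀ → ∀ s ∈ (fun K => Finset.range (K + 1)) K,
      SlotAntiConcentration (volume.restrict (Icc (0 : ℝ) 1)) (fun y : ℝ => y) 1
        (Toy.ρ ϑ ((fun (_ : ℕ) (s : ℕ) => s) K s)) (Toy.D ((fun (_ : ℕ) (s : ℕ) => s) K s))) ∧
    (∀ j, Toy.D j ≤ (1 : ℝ)) ∧ (∀ j, Toy.ρ ϑ j ≤ 1 * ϑ ^ j) ∧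
    (∀ (N₁ : ℕ) (νbar : ℝ), ¬ LiveWindow (fun K => Finset.range (K + 1)) (fun (_ : ℕ) (s : ℕ) => s) N₁ νbar) ∧
    ∀ Wsh : ℕ → ℝ, ¬ ShellWeightBound l₀ Toy.T Toy.A Toy.A Toy.A Toy.A Wsh :=
  ⟨fun _ _ _ _ _ => zero_le_one, fun _ _ _ _ _ => le_rfl, allLevels_cover l₀ h0.le, fun _ _ _ _ _ => zero_le_one,
    allLevels_piece_le l₀ h0.le h1.le, allLevels_total_ge l₀, fun _ => zero_le_one, fun j => pow_nonneg h0.le j,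
    allLevels_slotAC l₀ h0.le h1.le, toy_D_le, toy_rate h0.le le_rfl, allLevels_not_liveWindow,
    not_shellWeightBound_full hl₀⟩

end AllLevels

/-! ## §5 [dict] PUSH NECESSITY: `piece_le`, `total_ge`, `cover` -/

section Pushes

variable {ϑ : ℝ} (l₀ : ℝ)

/-- **`piece_le` FAILS** when the piece is the whole weight `1` but the slot's uniform shell mass is `ϑ^K < 1`
(`0 ≤ ϑ < 1`, step `K ≥ 1`). [folklore] -/
theorem noPieceLe_not_piece_le (h0 : 0 ≤ ϑ) (h1 : ϑ < 1) {K : ℕ} (hK : K ≠ 0) (t : ℝ) :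
    ¬ (∑ τ ∈ Toy.T K, (fun (_ : ℕ) (_ : ℝ) (_ : Unit) (_ : Unit) => (1 : ℝ)) K t () τ ≤
      1 * ((volume.restrict (Icc (0 : ℝ) 1))
        {y : ℝ | 1 * (1 - Toy.ρ ϑ (Toy.lvl K ())) ≤ (fun y : ℝ => y) y ∧ (fun y : ℝ => y) y < 1}).toReal) := by
  show ¬ (∑ τ ∈ Toy.T K, (1 : ℝ) ≤
    1 * ((volume.restrict (Icc (0 : ℝ) 1)) {y : ℝ | 1 * (1 - ϑ ^ K) ≤ y ∧ y < 1}).toReal)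
  rw [unif_shell (pow_le_one₀ h0 h1.le), ENNReal.toReal_ofReal (pow_nonneg h0 K)]
  simpa [Toy.T] using pow_lt_one₀ h0 h1 hK

/-- **`piece_le` NECESSITY CENSUS.**  On the uniform one-slot model with geometric widths `ρ_j = ϑ^j`
(`0 < ϑ < 1`, `0 ≤ l₀`) but the piece AND the shell part equal to the whole weight `1`, EVERY binder of END-I except
`piece_le` holds — (R), [dict] `hM`∕`total_ge`, `hD0`∕`hρ0`, THE WALL (M1) (S10's `toy_slotAC`), the window,
`D_j ≤ D̄ = 1`, the geometric rate —, `piece_le` FAILS at every step `K ≥ 1`, and `ShellWeightBound` FAILS FOR EVERY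
`Wsh`: the push of the expansion's pieces onto the SHELL mass is load-bearing. [folklore] -/
theorem noPieceLe_census (hl₀ : 0 ≤ l₀) (h0 : 0 < ϑ) (h1 : ϑ < 1) :
    (∀ K (t : ℝ), |t| ≤ l₀ → ∀ τ ∈ Toy.T K, 0 ≤ Toy.A K t τ) ∧
    (∀ K (t : ℝ), |t| ≤ l₀ → ∀ τ ∈ Toy.T K, Toy.A K t τ ≤ Toy.A K t τ) ∧
    (∀ K (t : ℝ), |t| ≤ l₀ → ∀ τ ∈ Toy.T K,
      Toy.A K t τ ≤ ∑ s ∈ Toy.S K, (fun (_ : ℕ) (_ : ℝ) (_ : Unit) (_ : Unit) => (1 : ℝ)) K t s τ) ∧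
    (∀ K (t : ℝ), |t| ≤ l₀ → ∀ s ∈ Toy.S K, (0 : ℝ) ≤ 1) ∧
    (∀ K (t : ℝ), |t| ≤ l₀ → ∀ s ∈ Toy.S K,
      1 * ((volume.restrict (Icc (0 : ℝ) 1)) (univ : Set ℝ)).toReal ≤ ∑ τ ∈ Toy.T K, Toy.A K t τ) ∧
    (∀ j, 0 ≤ Toy.D j) ∧ (∀ j, 0 ≤ Toy.ρ ϑ j) ∧
    (∀ K (t : ℝ), |t| ≤ l₀ → ∀ s ∈ Toy.S K, SlotAntiConcentration (volume.restrict (Icc (0 : ℝ) 1))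
      (fun y : ℝ => y) 1 (Toy.ρ ϑ (Toy.lvl K s)) (Toy.D (Toy.lvl K s))) ∧
    LiveWindow Toy.S Toy.lvl 0 1 ∧ (∀ j, Toy.D j ≤ (1 : ℝ)) ∧ (∀ j, Toy.ρ ϑ j ≤ 1 * ϑ ^ j) ∧
    (∀ K ≠ 0, ∀ t : ℝ, ¬ (∑ τ ∈ Toy.T K, (fun (_ : ℕ) (_ : ℝ) (_ : Unit) (_ : Unit) => (1 : ℝ)) K t () τ ≤
      1 * ((volume.restrict (Icc (0 : ℝ) 1))
        {y : ℝ | 1 * (1 - Toy.ρ ϑ (Toy.lvl K ())) ≤ (fun y : ℝ => y) y ∧ (fun y : ℝ => y) y < 1}).toReal)) ∧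
    ∀ Wsh : ℕ → ℝ, ¬ ShellWeightBound l₀ Toy.T Toy.A Toy.A Toy.A Toy.A Wsh :=
  ⟨fun _ _ _ _ _ => zero_le_one, fun _ _ _ _ _ => le_rfl, dirac_cover l₀, toy_M_nonneg l₀, toy_total_ge l₀,
    fun _ => zero_le_one, fun j => pow_nonneg h0.le j, toy_slotAC l₀ h0.le h1.le, Toy.liveWindow, toy_D_le,
    toy_rate h0.le le_rfl, fun _ hK t => noPieceLe_not_piece_le h0.le h1 hK t, not_shellWeightBound_full hl₀⟩

/-- [dict] PUSH `piece_le` HOLDS for the piece `1` once the [dict] constant may explode: `M_K := (ϑ^K)⁻¹` times the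
uniform shell mass `ϑ^K` is `1` (`0 < ϑ ≤ 1`). [folklore] -/
theorem noTotalGe_piece_le (h0 : 0 < ϑ) (h1 : ϑ ≤ 1) : ∀ K (t : ℝ), |t| ≤ l₀ → ∀ s ∈ Toy.S K,
    ∑ τ ∈ Toy.T K, (fun (_ : ℕ) (_ : ℝ) (_ : Unit) (_ : Unit) => (1 : ℝ)) K t s τ ≤
      (fun (K : ℕ) (_ : ℝ) (_ : Unit) => (ϑ ^ K)⁻¹) K t s * ((volume.restrict (Icc (0 : ℝ) 1))
        {y : ℝ | 1 * (1 - Toy.ρ ϑ (Toy.lvl K s)) ≤ (fun y : ℝ => y) y ∧ (fun y : ℝ => y) y < 1}).toReal := by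
  intro K t _ s _
  show ∑ τ ∈ Toy.T K, (1 : ℝ) ≤
    (ϑ ^ K)⁻¹ * ((volume.restrict (Icc (0 : ℝ) 1)) {y : ℝ | 1 * (1 - ϑ ^ K) ≤ y ∧ y < 1}).toReal
  rw [unif_shell (pow_le_one₀ h0.le h1), ENNReal.toReal_ofReal (pow_nonneg h0.le K),
    inv_mul_cancel₀ (pow_ne_zero K h0.ne')]
  simp [Toy.T]

/-- the exploding [dict] constants are nonnegative (binder `hM`). [folklore] -/
theorem noTotalGe_M_nonneg (h0 : 0 < ϑ) : ∀ K (t : ℝ), |t| ≤ l₀ → ∀ s ∈ Toy.S K,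
    0 ≤ (fun (K : ℕ) (_ : ℝ) (_ : Unit) => (ϑ ^ K)⁻¹) K t s :=
  fun K _ _ _ _ => inv_nonneg.2 (pow_nonneg h0.le K)

/-- **`total_ge` FAILS** with the exploding constant: `M_K·μ(univ) = ϑ^{−K} > 1 = Σ A` at every step `K ≥ 1`
(`0 < ϑ < 1`). [folklore] -/
theorem noTotalGe_not_total_ge (h0 : 0 < ϑ) (h1 : ϑ < 1) {K : ℕ} (hK : K ≠ 0) (t : ℝ) :
    ¬ ((fun (K : ℕ) (_ : ℝ) (_ : Unit) => (ϑ ^ K)⁻¹) K t () * ((volume.restrict (Icc (0 : ℝ) 1))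
      (univ : Set ℝ)).toReal ≤ ∑ τ ∈ Toy.T K, Toy.A K t τ) := by
  show ¬ ((ϑ ^ K)⁻¹ * ((volume.restrict (Icc (0 : ℝ) 1)) (univ : Set ℝ)).toReal ≤ ∑ τ ∈ Toy.T K, Toy.A K t τ)
  rw [unif_univ]
  simpa [Toy.T, Toy.A] using (one_lt_inv₀ (pow_pos h0 K)).2 (pow_lt_one₀ h0.le h1 hK)

/-- **`total_ge` NECESSITY CENSUS.**  On the uniform one-slot model with geometric widths, piece = shell part `= 1 = A`
and the exploding [dict] constant `M_K := (ϑ^K)⁻¹` (`0 < ϑ < 1`, `0 ≤ l₀`) EVERY binder of END-I except `total_ge`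
holds — (R), [dict] `hM`∕`piece_le`, `hD0`∕`hρ0`, THE WALL (M1), the window, `D_j ≤ D̄ = 1`, the geometric rate —,
`total_ge` FAILS at every step `K ≥ 1`, and `ShellWeightBound` FAILS FOR EVERY `Wsh`: the push of `M ×` the TOTAL
mass under the term weight is load-bearing. [folklore] -/
theorem noTotalGe_census (hl₀ : 0 ≤ l₀) (h0 : 0 < ϑ) (h1 : ϑ < 1) :
    (∀ K (t : ℝ), |t| ≤ l₀ → ∀ τ ∈ Toy.T K, 0 ≤ Toy.A K t τ) ∧
    (∀ K (t : ℝ), |t| ≤ l₀ → ∀ τ ∈ Toy.T K, Toy.A K t τ ≤ Toy.A K t τ) ∧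
    (∀ K (t : ℝ), |t| ≤ l₀ → ∀ τ ∈ Toy.T K,
      Toy.A K t τ ≤ ∑ s ∈ Toy.S K, (fun (_ : ℕ) (_ : ℝ) (_ : Unit) (_ : Unit) => (1 : ℝ)) K t s τ) ∧
    (∀ K (t : ℝ), |t| ≤ l₀ → ∀ s ∈ Toy.S K, 0 ≤ (fun (K : ℕ) (_ : ℝ) (_ : Unit) => (ϑ ^ K)⁻¹) K t s) ∧
    (∀ K (t : ℝ), |t| ≤ l₀ → ∀ s ∈ Toy.S K,
      ∑ τ ∈ Toy.T K, (fun (_ : ℕ) (_ : ℝ) (_ : Unit) (_ : Unit) => (1 : ℝ)) K t s τ ≤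
        (fun (K : ℕ) (_ : ℝ) (_ : Unit) => (ϑ ^ K)⁻¹) K t s * ((volume.restrict (Icc (0 : ℝ) 1))
          {y : ℝ | 1 * (1 - Toy.ρ ϑ (Toy.lvl K s)) ≤ (fun y : ℝ => y) y ∧ (fun y : ℝ => y) y < 1}).toReal) ∧
    (∀ j, 0 ≤ Toy.D j) ∧ (∀ j, 0 ≤ Toy.ρ ϑ j) ∧
    (∀ K (t : ℝ), |t| ≤ l₀ → ∀ s ∈ Toy.S K, SlotAntiConcentration (volume.restrict (Icc (0 : ℝ) 1))
      (fun y : ℝ => y) 1 (Toy.ρ ϑ (Toy.lvl K s)) (Toy.D (Toy.lvl K s))) ∧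
    LiveWindow Toy.S Toy.lvl 0 1 ∧ (∀ j, Toy.D j ≤ (1 : ℝ)) ∧ (∀ j, Toy.ρ ϑ j ≤ 1 * ϑ ^ j) ∧
    (∀ K ≠ 0, ∀ t : ℝ, ¬ ((fun (K : ℕ) (_ : ℝ) (_ : Unit) => (ϑ ^ K)⁻¹) K t () *
      ((volume.restrict (Icc (0 : ℝ) 1)) (univ : Set ℝ)).toReal ≤ ∑ τ ∈ Toy.T K, Toy.A K t τ)) ∧
    ∀ Wsh : ℕ → ℝ, ¬ ShellWeightBound l₀ Toy.T Toy.A Toy.A Toy.A Toy.A Wsh :=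
  ⟨fun _ _ _ _ _ => zero_le_one, fun _ _ _ _ _ => le_rfl, dirac_cover l₀, noTotalGe_M_nonneg l₀ h0,
    noTotalGe_piece_le l₀ h0 h1.le, fun _ => zero_le_one, fun j => pow_nonneg h0.le j, toy_slotAC l₀ h0.le h1.le,
    Toy.liveWindow, toy_D_le, toy_rate h0.le le_rfl, fun _ hK t => noTotalGe_not_total_ge h0 h1 hK t,
    not_shellWeightBound_full hl₀⟩

/-- with NO slots every per-slot binder of END-I (`hM`, `piece_le`, `total_ge`, `hac`) holds VACUOUSLY. [folklore] -/
theorem noCover_vacuous (P : ℕ → ℝ → Unit → Prop) :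
    ∀ K (t : ℝ), |t| ≤ l₀ → ∀ s ∈ (fun _ : ℕ => (∅ : Finset Unit)) K, P K t s :=
  fun _ _ _ _ hs => absurd hs (Finset.notMem_empty _)

/-- with NO slots the window is trivially live (any depth, any count `ν̄ ≥ 0`). [folklore] -/
theorem noCover_liveWindow (N₁ : ℕ) {νbar : ℝ} (hν : 0 ≤ νbar) :
    LiveWindow (fun _ : ℕ => (∅ : Finset Unit)) Toy.lvl N₁ νbar where
  recent _ _ hs := absurd hs (Finset.notMem_empty _)
  le_top _ _ hs := absurd hs (Finset.notMem_empty _)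
  count K j := by simpa using hν

/-- **`cover` FAILS** with no slots: the positive shell part `1` is not covered by the empty sum of pieces. [folklore] -/
theorem noCover_not_cover (K : ℕ) (t : ℝ) :
    ¬ (Toy.A K t () ≤ ∑ s ∈ (fun _ : ℕ => (∅ : Finset Unit)) K,
      (fun (_ : ℕ) (_ : ℝ) (_ : Unit) (_ : Unit) => (1 : ℝ)) K t s ()) := by
  simp [Toy.A]

/-- **`cover` NECESSITY CENSUS.**  With NO slots at all (`S ≡ ∅`; shell part `= 1 = A`, `0 ≤ l₀`, any widths and
constants, here `ρ_j = ϑ^j`, `D ≡ 1`, `0 < ϑ`) EVERY binder of END-I except `cover` holds — (R)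
`sh_nonneg`∕`sh_le`, ALL per-slot binders ([dict] `hM`∕`piece_le`∕`total_ge` and THE WALL (M1)) vacuously,
`hD0`∕`hρ0`, the window (trivially), `D_j ≤ D̄ = 1`, the geometric rate —, `cover` FAILS at every step, and
`ShellWeightBound` FAILS FOR EVERY `Wsh`: the expansion reading (R) «the shell part is covered by the slots' pieces»
is what lets any slot estimate touch the shell weight at all. [folklore] -/
theorem noCover_census (hl₀ : 0 ≤ l₀) (h0 : 0 < ϑ) (P : ℕ → ℝ → Unit → Prop) :
    (∀ K (t : ℝ), |t| ≤ l₀ → ∀ τ ∈ Toy.T K, 0 ≤ Toy.A K t τ) ∧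
    (∀ K (t : ℝ), |t| ≤ l₀ → ∀ τ ∈ Toy.T K, Toy.A K t τ ≤ Toy.A K t τ) ∧
    (∀ K (t : ℝ), |t| ≤ l₀ → ∀ s ∈ (fun _ : ℕ => (∅ : Finset Unit)) K, P K t s) ∧
    (∀ j, 0 ≤ Toy.D j) ∧ (∀ j, 0 ≤ Toy.ρ ϑ j) ∧
    LiveWindow (fun _ : ℕ => (∅ : Finset Unit)) Toy.lvl 0 1 ∧ (∀ j, Toy.D j ≤ (1 : ℝ)) ∧
    (∀ j, Toy.ρ ϑ j ≤ 1 * ϑ ^ j) ∧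
    (∀ (K : ℕ) (t : ℝ), ¬ (Toy.A K t () ≤ ∑ s ∈ (fun _ : ℕ => (∅ : Finset Unit)) K,
      (fun (_ : ℕ) (_ : ℝ) (_ : Unit) (_ : Unit) => (1 : ℝ)) K t s ())) ∧
    ∀ Wsh : ℕ → ℝ, ¬ ShellWeightBound l₀ Toy.T Toy.A Toy.A Toy.A Toy.A Wsh :=
  ⟨fun _ _ _ _ _ => zero_le_one, fun _ _ _ _ _ => le_rfl, noCover_vacuous l₀ P, fun _ => zero_le_one,
    fun j => pow_nonneg h0.le j, noCover_liveWindow 0 zero_le_one, toy_D_le, toy_rate h0.le le_rfl,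
    noCover_not_cover, not_shellWeightBound_full hl₀⟩

end Pushes

end Summit.QuantumFields.BalabanUV.T4Continuum.ShellMeasureRootCompositionNecessityLevels
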